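import Summits.RiemannHypothesis.RiemannHypothesis.Theorems.WeilTwoPrimeDeflM80XBase
import Literature.NumberTheory.LFunctions.WeilBlockRows
import Literature.NumberTheory.LFunctions.WeilBlockRowsPZ
import Summits.RiemannHypothesis.RiemannHypothesis.Theorems.WeilTwoPrimeDeflM80PDataDnE18
import HarnessLib

/-!
# Calibration certificate M80X: rows 66–71 of the even `D C = I` and rows 74–77 of the claim `D = Dn / Ls` for M80P's factored even inverse

`WeilCert.checkDCRow 0` (6 rows) and `WeilCert.checkDnRow` (4 rows, `weilCertDeflM80XDnE` / `weilCertDeflM80PLsE`) for certificate M80X, by `decide +kernel` (gen3 re-split: ≤ 6 DC rows per file for the gate's 600-s elaboration cap under the farm's load variance). Pure proof file.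
-/

set_option linter.dupNamespace false

noncomputable section

namespace Summit.RiemannHypothesis.RiemannHypothesis.Theorems.EvenWinsBeyondArch

open Literature.NumberTheory.LFunctions

set_option maxHeartbeats 0 in
/-- Kernel check of row 66 of the even `D C = I` (certificate M80X). [folklore] -/
theorem checkDCRow0_66_weilCertDeflM80X : weilCertDeflM80XBase.checkDCRow 0 66 = true := by
  decide +kernel

set_option maxHeartbeats 0 in
/-- Kernel check of row 67 of the even `D C = I` (certificate M80X). [folklore] -/
theorem checkDCRow0_67_weilCertDeflM80X : weilCertDeflM80XBase.checkDCRow 0 67 = true := by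
  decide +kernel

set_option maxHeartbeats 0 in
/-- Kernel check of row 68 of the even `D C = I` (certificate M80X). [folklore] -/
theorem checkDCRow0_68_weilCertDeflM80X : weilCertDeflM80XBase.checkDCRow 0 68 = true := by
  decide +kernel

set_option maxHeartbeats 0 in
/-- Kernel check of row 69 of the even `D C = I` (certificate M80X). [folklore] -/
theorem checkDCRow0_69_weilCertDeflM80X : weilCertDeflM80XBase.checkDCRow 0 69 = true := by
  decide +kernel

set_option maxHeartbeats 0 in
/-- Kernel check of row 70 of the even `D C = I` (certificate M80X). [folklore] -/
theorem checkDCRow0_70_weilCertDeflM80X : weilCertDeflM80XBase.checkDCRow 0 70 = true := by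
  decide +kernel

set_option maxHeartbeats 0 in
/-- Kernel check of row 71 of the even `D C = I` (certificate M80X). [folklore] -/
theorem checkDCRow0_71_weilCertDeflM80X : weilCertDeflM80XBase.checkDCRow 0 71 = true := by
  decide +kernel

-- ===== factored even inverse `D = Dn / Ls`: rows 74–77 =====
set_option maxHeartbeats 0 in
/-- Row 74 of `DnE/LsE` is row 74 of the even `D` (certificate M80X). [folklore] -/
theorem checkDnRow0_74_weilCertDeflM80X : weilCertDeflM80XBase.checkDnRow weilCertDeflM80XDnE weilCertDeflM80PLsE 0 74 = true := by
  decide +kernel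

set_option maxHeartbeats 0 in
/-- Row 75 of `DnE/LsE` is row 75 of the even `D` (certificate M80X). [folklore] -/
theorem checkDnRow0_75_weilCertDeflM80X : weilCertDeflM80XBase.checkDnRow weilCertDeflM80XDnE weilCertDeflM80PLsE 0 75 = true := by
  decide +kernel

set_option maxHeartbeats 0 in
/-- Row 76 of `DnE/LsE` is row 76 of the even `D` (certificate M80X). [folklore] -/
theorem checkDnRow0_76_weilCertDeflM80X : weilCertDeflM80XBase.checkDnRow weilCertDeflM80XDnE weilCertDeflM80PLsE 0 76 = true := by
  decide +kernel

set_option maxHeartbeats 0 in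
/-- Row 77 of `DnE/LsE` is row 77 of the even `D` (certificate M80X). [folklore] -/
theorem checkDnRow0_77_weilCertDeflM80X : weilCertDeflM80XBase.checkDnRow weilCertDeflM80XDnE weilCertDeflM80PLsE 0 77 = true := by
  decide +kernel

end Summit.RiemannHypothesis.RiemannHypothesis.Theorems.EvenWinsBeyondArch

end
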